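/-
# `1 − R(u)` IS INVERTIBLE from the step family's block letters (Gershgorin); the `s ≡ 1` identification WITHOUT `hunit`

Cell `pub-balaban-gaps`, seat **g1-p2 GEN 5** (prover), row **(D4)**.  Files 33 (`glued_one_eq_inv`), 36 (`locInv_letters`),
45 (`decKernel_one_eq_inv`) and 47 (`accretive_print_one_eq_inv`) identify the `s ≡ 1` kernel of the one-scale expansion
with `Δ′(u)⁻¹ = (1 + K′(u))⁻¹` under the OPAQUE hypothesis `hunit : IsUnit (1 − R(u)).det` (print, (3.90) p.409: «G′ =
G′₀(I − R)⁻¹ … for M sufficiently large»).  This file DISCHARGES it from primitive letters: by Gershgorin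
(`det_ne_zero_of_sum_row_lt_diag`) a complex matrix with all absolute row sums `< 1` has `1 − R` invertible (§1); the
absolute row sums of the `s ≡ 1` kernel `Σ_□ R_□(u)` of a block-local family (blocks in `dom □ × dom □`, block bound `λ_R`,
`#dom □ ≤ n_C`, every cube in at most `n_B` domains) are `≤ n_B·n_C·λ_R` (§2); hence `1 − R(u)` is invertible on the ball
under the SMALLNESS `n_Bn_Cλ_R < 1` — the same `O(λ_R) = O(M⁻¹)` currency as the Neumann margin — and the `s ≡ 1`
identifications of 45 and 47 hold WITHOUT `hunit` (§3).
HONEST FRAMING: packaging at MODEL generality (letters are hypotheses on `Δ′`'s local inverses ∕ commutators); Bałaban's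
operators not touched; (D4) instance 0∕1; NOT continuum, NOT Clay.

References: T. Bałaban, Comm. Math. Phys. 99 (1985) 389–434 [B9], Thm 3.7 (3.88)–(3.90) p.409, Cor 3.8 p.410; Comm. Math.
Phys. 116 (1988) 1–22 [II], p.3, (1.11) p.5.
-/
import Summits.QuantumFields.BalabanUV.Gaps.D4WalkBlockAccretiveDecay
import Mathlib.LinearAlgebra.Matrix.Gershgorin

noncomputable section

namespace Summit.QuantumFields.BalabanUV.Gaps.D4WalkBlockStepUnit

open Metric Finset
open Literature.MathematicalPhysics.QuantumFieldTheory.Balaban1983to89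
open Literature.MathematicalPhysics.QuantumFieldTheory.Balaban1983to89.B9Thm37GlueTorus (tdist1)
open Literature.MathematicalPhysics.QuantumFieldTheory.Balaban1983to89.TreeLengthTorus (TPt)
open Literature.MathematicalPhysics.QuantumFieldTheory.Balaban1983to89.B5TorusCover (UT)
open Literature.MathematicalPhysics.QuantumFieldTheory.Balaban1983to89.B5Prop11Lower (nsq)
open Literature.MathematicalPhysics.QuantumFieldTheory.Balaban1983to89.B13DomainKernelWalks (DomainTerms)
open Summit.QuantumFields.BalabanUV.Gaps.D4WalkBlock (rowMass blockNorm blockNorm_nonneg rowMass_le_blockNorm)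
open Summit.QuantumFields.BalabanUV.Gaps.D4WalkBlockLocalDecay (IsDomainLocalBD)
open Summit.QuantumFields.BalabanUV.Gaps.D4WalkBlockDecorate (decKernel)
open Summit.QuantumFields.BalabanUV.Gaps.D4WalkBlockParametrixDecay (decKernel_one_eq_inv)
open Summit.QuantumFields.BalabanUV.Gaps.D4WalkBlockAccretiveDecay (accretive_print_one_eq_inv)
open Summit.QuantumFields.BalabanUV.T4Continuum.Spine.NE5.TwoRunPencilDomains (withOp)
open Summit.QuantumFields.BalabanUV.Beta.UnitLatticeWalkInversion (Hd Pj)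
open Summit.QuantumFields.BalabanUV.Beta.UnitLatticeLocalInverse (compress extend)
open Summit.QuantumFields.BalabanUV.Beta.AccretiveCombesThomas (conjForm)

variable {n : Type} [Fintype n] [DecidableEq n]

/-! ## §1. Gershgorin: absolute row sums `< 1` make `1 − R` invertible -/

/-- **`1 − R` IS INVERTIBLE WHEN EVERY ABSOLUTE ROW SUM OF `R` IS `< 1`** (row strict diagonal dominance of `1 − R`;
Gershgorin). [folklore] -/
theorem isUnit_det_one_sub_of_rowSum_lt_one (Rm : Matrix n n ℂ) (h : ∀ i, ∑ j, ‖Rm i j‖ < 1) : IsUnit (1 - Rm).det := by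
  refine isUnit_iff_ne_zero.2 (det_ne_zero_of_sum_row_lt_diag fun k => ?_)
  have h1 : ∑ j ∈ univ.erase k, ‖(1 - Rm) k j‖ = ∑ j ∈ univ.erase k, ‖Rm k j‖ :=
    Finset.sum_congr rfl fun j hj => by
      rw [Matrix.sub_apply, Matrix.one_apply_ne (Finset.ne_of_mem_erase hj).symm, zero_sub, norm_neg]
  have h2 : ∑ j ∈ univ.erase k, ‖Rm k j‖ = ∑ j, ‖Rm k j‖ - ‖Rm k k‖ := Finset.sum_erase_eq_sub (Finset.mem_univ k)
  have h3 : 1 - ‖Rm k k‖ ≤ ‖(1 - Rm) k k‖ := by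
    rw [Matrix.sub_apply, Matrix.one_apply_eq]
    have := norm_sub_norm_le (1 : ℂ) (Rm k k)
    rwa [norm_one] at this
  rw [h1, h2]
  linarith [h k]

/-! ## §2. Absolute row sums of the `s ≡ 1` kernel of a block-local family -/

section RowSums

variable {d N' : ℕ} {ν : ℕ} {K : Fin ν → ℕ} [∀ i, NeZero (K i)]
variable {E : Type*} [NormedAddCommGroup E] [NormedSpace ℂ E]

omit [DecidableEq n] [∀ i, NeZero (K i)] in
/-- Absolute row sums are sums of row masses over the column cubes. [folklore] -/
theorem rowSum_eq_sum_rowMass (cubn : n → UT K) (T : Matrix n n ℂ) (i : n) :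
    ∑ j, ‖T i j‖ = ∑ y' : UT K, rowMass cubn T i y' := by
  unfold rowMass
  exact (Finset.sum_fiberwise (Finset.univ : Finset n) cubn fun j => ‖T i j‖).symm

omit [DecidableEq n] [∀ i, NeZero (K i)] in
/-- **Absolute row sums of ONE block-local coefficient**: blocks inside `dom □ × dom □`, block bound `λ`, `#dom □ ≤ n_C` ⟹
`Σ_j ‖F_□(i,j)‖ ≤ n_C·λ` if `cubn i ∈ dom □`, and `= 0` otherwise. [cite: Balaban1985BackgroundPropagators, (3.89) p.409] -/
theorem rowSum_le_of_blocks (cubn : n → UT K) (T : Matrix n n ℂ) (dom : Finset (UT K)) {lam : ℝ} {nC : ℕ}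
    (hlam : 0 ≤ lam) (hsupp : ∀ y y', blockNorm cubn cubn T y y' ≠ 0 → y ∈ dom ∧ y' ∈ dom)
    (hbd : ∀ y y', blockNorm cubn cubn T y y' ≤ lam) (hcard : dom.card ≤ nC) (i : n) :
    ∑ j, ‖T i j‖ ≤ if cubn i ∈ dom then (nC : ℝ) * lam else 0 := by
  classical
  rw [rowSum_eq_sum_rowMass cubn]
  have hterm : ∀ y', rowMass cubn T i y' ≤ if cubn i ∈ dom ∧ y' ∈ dom then lam else 0 := by
    intro y'
    split_ifs with hy
    · exact (rowMass_le_blockNorm cubn cubn T i y').trans (hbd _ _)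
    · have h0 : blockNorm cubn cubn T (cubn i) y' = 0 := by
        by_contra h0; exact hy (hsupp _ _ h0)
      exact (rowMass_le_blockNorm cubn cubn T i y').trans h0.le
  refine (Finset.sum_le_sum fun y' _ => hterm y').trans ?_
  split_ifs with hi
  · calc ∑ y' : UT K, (if cubn i ∈ dom ∧ y' ∈ dom then lam else 0) = ∑ y' : UT K, (if y' ∈ dom then lam else 0) :=
          Finset.sum_congr rfl fun y' _ => by simp only [hi, true_and]
      _ = dom.card * lam := by rw [Finset.sum_ite_mem, Finset.univ_inter, Finset.sum_const, nsmul_eq_mul]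
      _ ≤ nC * lam := mul_le_mul_of_nonneg_right (by exact_mod_cast hcard) hlam
  · exact le_of_eq (Finset.sum_eq_zero fun y' _ => by simp only [hi, false_and, if_false])

omit [DecidableEq n] in
/-- **ABSOLUTE ROW SUMS OF THE `s ≡ 1` KERNEL `Σ_□ F_□(u)`** of a family with blocks in `dom □ × dom □`, block bound `λ` on the
ball, `#dom □ ≤ n_C` and COVERING MULTIPLICITY `#{□ : y ∈ dom □} ≤ n_B`: `Σ_j ‖(Σ_□ F_□(u))(i,j)‖ ≤ n_B·n_C·λ`.
[cite: Balaban1985BackgroundPropagators, (3.88)–(3.89) p.409, Cor 3.8 p.410] -/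
theorem rowSum_kernel_one_le (L : DomainTerms d N' ν K n n E) (cubn : n → UT K) {R lam : ℝ} {nC nB : ℕ} (hlam : 0 ≤ lam)
    (hsuppB : ∀ b u y y', blockNorm cubn cubn (L.op b u) y y' ≠ 0 → y ∈ L.dom b ∧ y' ∈ L.dom b)
    (hbdB : ∀ b, ∀ u ∈ ball (0 : E) R, ∀ y y', blockNorm cubn cubn (L.op b u) y y' ≤ lam)
    (hcard : ∀ b, (L.dom b).card ≤ nC) (hcov : ∀ y : UT K, (Finset.univ.filter fun b => y ∈ L.dom b).card ≤ nB)
    (u : E) (hu : u ∈ ball (0 : E) R) (i : n) :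
    ∑ j, ‖L.kernel (fun _ => (1 : ℂ)) u i j‖ ≤ nB * nC * lam := by
  classical
  have hker : L.kernel (fun _ => (1 : ℂ)) u = ∑ b, L.op b u := by
    show (∑ b, (∏ _j ∈ L.J b, (1 : ℂ)) • L.op b u) = ∑ b, L.op b u
    exact Finset.sum_congr rfl fun b _ => by rw [Finset.prod_const_one, one_smul]
  rw [hker]
  calc ∑ j, ‖(∑ b, L.op b u) i j‖ ≤ ∑ j, ∑ b, ‖L.op b u i j‖ :=
        Finset.sum_le_sum fun j _ => by rw [Matrix.sum_apply]; exact norm_sum_le _ _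
    _ = ∑ b, ∑ j, ‖L.op b u i j‖ := Finset.sum_comm
    _ ≤ ∑ b, (if cubn i ∈ L.dom b then (nC : ℝ) * lam else 0) := Finset.sum_le_sum fun b _ =>
        rowSum_le_of_blocks cubn (L.op b u) (L.dom b) hlam (hsuppB b u) (hbdB b u hu) (hcard b) i
    _ = ((Finset.univ.filter fun b => cubn i ∈ L.dom b).card : ℝ) * (nC * lam) := by
        rw [← Finset.sum_filter, Finset.sum_const, nsmul_eq_mul]
    _ ≤ nB * (nC * lam) := mul_le_mul_of_nonneg_right (by exact_mod_cast hcov (cubn i)) (by positivity)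
    _ = nB * nC * lam := by ring

/-- **`1 − R(u)` IS INVERTIBLE ON THE BALL** for the `s ≡ 1` kernel `R(u) = Σ_□ R_□(u)` of a DECAYING block-local family
(`IsDomainLocalBD`, `ρ ≥ 0`) with `#dom □ ≤ n_C`, covering multiplicity `n_B`, under the smallness `n_Bn_Cλ_R < 1` — print's
«for M sufficiently large» at (3.90). [cite: Balaban1985BackgroundPropagators, (3.90) p.409, Cor 3.8 p.410] -/
theorem isUnit_det_one_sub_kernel_one {L : DomainTerms d N' ν K n n E} {c : B13.Consts} {cubn : n → UT K}
    {X : Finset (UT K)} {R lam ρ r : ℝ} {mJ nD nC nB : ℕ} (hL : IsDomainLocalBD L c cubn cubn X R lam ρ r mJ nD)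
    (hρ : 0 ≤ ρ) (hlam : 0 ≤ lam) (hcard : ∀ b, (L.dom b).card ≤ nC)
    (hcov : ∀ y : UT K, (Finset.univ.filter fun b => y ∈ L.dom b).card ≤ nB) (hsmall : (nB : ℝ) * nC * lam < 1)
    (u : E) (hu : u ∈ ball (0 : E) R) : IsUnit (1 - L.kernel (fun _ => (1 : ℂ)) u).det :=
  isUnit_det_one_sub_of_rowSum_lt_one _ fun i =>
    (rowSum_kernel_one_le L cubn hlam hL.hsuppB (hL.toB hρ hlam).hbdB hcard hcov u hu i).trans_lt hsmall

end RowSums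

/-! ## §3. The `s ≡ 1` identifications of files 45 and 47 WITHOUT `hunit` -/

section Discharge

variable {d N' : ℕ} {ν : ℕ} {K : Fin ν → ℕ} [∀ i, NeZero (K i)]
variable {E : Type*} [NormedAddCommGroup E] [NormedSpace ℂ E]
variable {L : DomainTerms d N' ν K n n E} {h : L.B → n → ℝ} {Es : L.B → Finset n} {K' : E → Matrix n n ℂ}
variable {c₀ : B13.Consts} {cubn : n → UT K} {R lamR ρ₀ r : ℝ} {nD nC nB : ℕ}

/-- **45's `decKernel_one_eq_inv` WITH `hunit` DISCHARGED**: given the step family's decaying block letter `(λ_R, ρ₀)` (45's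
`isDomainLocalBD_step` supplies it with `λ_R = n_Cλ_KC_L`), `#dom □ ≤ n_C`, covering multiplicity `n_B` and `n_Bn_Cλ_R < 1`, the
`s ≡ 1` kernel of the print-decorated expansion is `(1 + K′(u))⁻¹` on the ball. [cite: Balaban1985BackgroundPropagators, (3.88)–(3.90) p.409; Balaban1988RG2Cluster, p.3] -/
theorem decKernel_one_eq_inv_of_small {W : Type} {T : W → (TPt d N' → ℂ) → E → Matrix n n ℂ}
    {dec : W → Finset (TPt d N')}
    (hker : ∀ u ∈ ball (0 : E) R, decKernel T dec (fun _ => 1) u =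
      (withOp L fun b u => Hd h b * L.op b u * Hd h b).kernel (fun _ => 1) u *
        ((1 : Matrix n n ℂ) + (-1 : ℂ) •
          (withOp L fun b u => (Hd h b * K' u - K' u * Hd h b) * L.op b u * Hd h b).kernel (fun _ => 1) u)⁻¹)
    (hsum : ∀ y, ∑ b, h b y ^ 2 = 1) (hsupp : ∀ b y, y ∉ Es b → h b y = 0)
    (hPL : ∀ b, ∀ u ∈ ball (0 : E) R, Pj Es b * L.op b u = L.op b u)
    (hinv : ∀ b, ∀ u ∈ ball (0 : E) R, Pj Es b * (1 + K' u) * Pj Es b * L.op b u = Pj Es b)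
    (hR : IsDomainLocalBD (withOp L fun b u => (Hd h b * K' u - K' u * Hd h b) * L.op b u * Hd h b) c₀ cubn cubn ∅ R
      lamR ρ₀ r 0 nD)
    (hρ₀ : 0 ≤ ρ₀) (hlamR : 0 ≤ lamR) (hcard : ∀ b, (L.dom b).card ≤ nC)
    (hcov : ∀ y : UT K, (Finset.univ.filter fun b => y ∈ L.dom b).card ≤ nB) (hsmall : (nB : ℝ) * nC * lamR < 1) :
    ∀ u ∈ ball (0 : E) R, decKernel T dec (fun _ => 1) u = (1 + K' u)⁻¹ :=
  decKernel_one_eq_inv hker hsum hsupp hPL hinv fun u hu =>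
    isUnit_det_one_sub_kernel_one hR hρ₀ hlamR hcard hcov hsmall u hu

variable {L₀ : DomainTerms d N' ν K n n E} {h₀ : L₀.B → n → ℝ} {Es₀ : L₀.B → Finset n} {ds : n → n → ℝ} {m κc : ℝ}

/-- **47's `accretive_print_one_eq_inv` WITH `hunit` DISCHARGED** (local inverses CONSTRUCTED; the step family's decaying letter
is 47's `blockNorm_comm_le_decay` ∘ 45's `isDomainLocalBD_step`, passed here as `hR`). [cite: Balaban1985BackgroundPropagators, (3.88)–(3.90) p.409; Balaban1988RG2Cluster, p.3] -/
theorem accretive_print_one_eq_inv_of_small {W : Type} {T : W → (TPt d N' → ℂ) → E → Matrix n n ℂ}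
    {dec : W → Finset (TPt d N')}
    (hker : ∀ u ∈ ball (0 : E) R, decKernel T dec (fun _ => 1) u =
      (withOp L₀ fun b u => Hd h₀ b * extend (compress (1 + K' u) (Es₀ b))⁻¹ * Hd h₀ b).kernel (fun _ => 1) u *
        ((1 : Matrix n n ℂ) + (-1 : ℂ) •
          (withOp L₀ fun b u =>
            (Hd h₀ b * K' u - K' u * Hd h₀ b) * extend (compress (1 + K' u) (Es₀ b))⁻¹ * Hd h₀ b).kernel (fun _ => 1) u)⁻¹)
    (hsum : ∀ y, ∑ b, h₀ b y ^ 2 = 1) (hsupp : ∀ b y, y ∉ Es₀ b → h₀ b y = 0) (hm : 0 < m)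
    (hcoer : ∀ u ∈ ball (0 : E) R, ∀ j, ∀ z : n → ℂ, m * nsq z ≤ (conjForm (1 + K' u) κc (fun e => ds e j) z).re)
    (hR : IsDomainLocalBD (withOp L₀ fun b u =>
      (Hd h₀ b * K' u - K' u * Hd h₀ b) * extend (compress (1 + K' u) (Es₀ b))⁻¹ * Hd h₀ b) c₀ cubn cubn ∅ R lamR ρ₀ r 0 nD)
    (hρ₀ : 0 ≤ ρ₀) (hlamR : 0 ≤ lamR) (hcard : ∀ b, (L₀.dom b).card ≤ nC)
    (hcov : ∀ y : UT K, (Finset.univ.filter fun b => y ∈ L₀.dom b).card ≤ nB) (hsmall : (nB : ℝ) * nC * lamR < 1) :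
    ∀ u ∈ ball (0 : E) R, decKernel T dec (fun _ => 1) u = (1 + K' u)⁻¹ :=
  accretive_print_one_eq_inv hker hsum hsupp hm hcoer fun u hu =>
    isUnit_det_one_sub_kernel_one hR hρ₀ hlamR hcard hcov hsmall u hu

end Discharge

end Summit.QuantumFields.BalabanUV.Gaps.D4WalkBlockStepUnit

end
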